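import Mathlib.Algebra.Homology.ShortComplex.ModuleCat
import Mathlib.Algebra.Homology.QuasiIso
import Mathlib.Algebra.Category.ModuleCat.Abelian
import Mathlib.LinearAlgebra.Dimension.Finrank
import HarnessLib

/-!
# The `map mkQ` model of the cohomology of a complex of modules is the categorical homology; invariance under quasi-isomorphisms
# ([Weibel1994] §1.1; [StacksProject] Tag 0111)

Layer `Literature/Algebra/Homology`, namespace `Literature.Algebra.Homology`.  THEOREMS ONLY (no definition, no named fact, no instance, no notation,
no `sorry`), Mathlib only.  Cell `hodgecm-mathlib` (D-0151), junction (J10-ii) of the «H1-DIM-ANY-CHAR cut» (B-p04 memo v3 §2).  The H1-DIM bricks ★ B3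
`BettiOneResidueField`, ★ `FreeComplexDoubleDualBaseChange`, ★ `BaseChangeComplexTowerHOne` read the degree-`j` cohomology of a cochain complex `K•` of `R`-modules
in the «map-`mkQ`» spelling `↥((ker d^{j,l}).map (range d^{i,j}).mkQ) ⊆ Kʲ ⧸ im d^{i,j}` (chosen because `↥Z ⧸ …` does not elaborate for the kernels at hand);
this file identifies that model with Mathlib's `K.homology j` and deduces its invariance under quasi-isomorphisms, so that the Grothendieck complex
`K• ⥲ Č•` (★ `exists_strictlyPerfect_quasiIso_cechComplex_of_isProper`) can be replaced by the Čech complex in `H¹` counts.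

* §1 `nonempty_kerMapMkQ_linearEquiv_kerQuotient` — `↥((ker g).map (range f).mkQ) ≃ₗ[R] ↥(ker g) ⧸ (range f).comap (ker g).subtype` for linear maps
  `f : X₀ → X₁`, `g : X₁ → X₂` (first isomorphism theorem for `mkQ ∘ subtype`).
* §2 **`nonempty_HmkQ_linearEquiv_homology`** — for `K : CochainComplex (ModuleCat R) ℤ` and `i + 1 = j`, `j + 1 = l`:
  `↥((ker (K.d j l).hom).map (range (K.d i j).hom).mkQ) ≃ₗ[R] K.homology j` (Mathlib `moduleCatHomologyIso` of `K.sc' i j l` + `homologyIsoSc'`).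
* §3 **`nonempty_HmkQ_linearEquiv_of_quasiIsoAt`**, **`finrank_HmkQ_eq_of_quasiIsoAt`** — for `F : K ⟶ L` a quasi-isomorphism in degree `j`, the map-`mkQ`
  cohomologies of `K` and `L` in degree `j` are `R`-isomorphic, hence have the same `finrank` over `R`.

HC_CM is proved only modulo the 7 printed citations until rung 0 closes; nothing here bears on a summit statement (count-neutral capital).

## References
* [Weibel1994] C. A. Weibel, *An introduction to homological algebra* (1994), §1.1 (Def. 1.1.1, Ex. 1.1.2) (p. 2).
* [StacksProject] The Stacks Project, Tag 0111 (cohomology of complexes; functoriality; quasi-isomorphisms).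
-/

set_option autoImplicit false

universe u

open CategoryTheory CategoryTheory.Limits HomologicalComplex

noncomputable section

namespace Literature.Algebra.Homology

/-! ## §1 `(ker g).map (range f).mkQ ≅ ker g ⧸ (range f ∩ ker g)` -/

section KerQuot

variable {R : Type u} [Ring R] {X₀ X₁ X₂ : Type u} [AddCommGroup X₀] [Module R X₀] [AddCommGroup X₁] [Module R X₁]
  [AddCommGroup X₂] [Module R X₂] (f : X₀ →ₗ[R] X₁) (g : X₁ →ₗ[R] X₂)

/-- **`↥((ker g).map (range f).mkQ) ≃ₗ[R] ↥(ker g) ⧸ (range f).comap (ker g).subtype`** — the first isomorphism theorem for the restriction of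
`mkQ : X₁ → X₁ ⧸ im f` to `ker g`. [cite: Weibel1994, §1.1 (Def. 1.1.1, Ex. 1.1.2)] -/
theorem nonempty_kerMapMkQ_linearEquiv_kerQuotient :
    Nonempty (↥((LinearMap.ker g).map (LinearMap.range f).mkQ) ≃ₗ[R]
      (↥(LinearMap.ker g) ⧸ (LinearMap.range f).comap (LinearMap.ker g).subtype)) := by
  let φ : ↥(LinearMap.ker g) →ₗ[R] X₁ ⧸ LinearMap.range f := (LinearMap.range f).mkQ.domRestrict (LinearMap.ker g)
  have hker : LinearMap.ker φ = (LinearMap.range f).comap (LinearMap.ker g).subtype := by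
    rw [LinearMap.ker_domRestrict, Submodule.ker_mkQ]
  have hrange : LinearMap.range φ = (LinearMap.ker g).map (LinearMap.range f).mkQ := LinearMap.range_domRestrict _ _
  exact ⟨((LinearEquiv.ofEq _ _ hrange).symm.trans (φ.quotKerEquivRange).symm).trans (Submodule.quotEquivOfEq _ _ hker)⟩

end KerQuot

/-! ## §2 The map-`mkQ` model is the categorical homology -/

section Homology

variable {R : Type u} [CommRing R] (K : CochainComplex (ModuleCat.{u} R) ℤ)

/-- The image of `toCycles : X₁ → ker g` of a short complex of modules is `im f ∩ ker g` read inside `ker g`. [cite: Weibel1994, §1.1 (Def. 1.1.1, Ex. 1.1.2)] -/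
theorem range_moduleCatToCycles_eq (S : ShortComplex (ModuleCat.{u} R)) :
    LinearMap.range S.moduleCatToCycles = (LinearMap.range S.f.hom).comap (LinearMap.ker S.g.hom).subtype := by
  ext z
  simp only [LinearMap.mem_range, Submodule.mem_comap, Submodule.subtype_apply]
  constructor
  · rintro ⟨x, rfl⟩
    exact ⟨x, rfl⟩
  · rintro ⟨x, hx⟩
    exact ⟨x, Subtype.ext hx⟩

/-- **THE MAP-`mkQ` MODEL IS THE HOMOLOGY**: for `i + 1 = j`, `j + 1 = l`,
`↥((ker (K.d j l)).map (range (K.d i j)).mkQ) ≃ₗ[R] K.homology j` (§1, then Mathlib's explicit left homology data of `K.sc' i j l` and `homologyIsoSc'`).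
[cite: Weibel1994, §1.1 (Def. 1.1.1, Ex. 1.1.2)] [cite: StacksProject, Tag 0111] -/
theorem nonempty_HmkQ_linearEquiv_homology (i j l : ℤ) (hij : i + 1 = j) (hjl : j + 1 = l) :
    Nonempty (↥((LinearMap.ker (K.d j l).hom).map (LinearMap.range (K.d i j).hom).mkQ) ≃ₗ[R] K.homology j) := by
  have hi : (ComplexShape.up ℤ).prev j = i := by rw [CochainComplex.prev]; omega
  have hl : (ComplexShape.up ℤ).next j = l := by rw [CochainComplex.next]; omega
  let S : ShortComplex (ModuleCat.{u} R) := K.sc' i j l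
  obtain ⟨e₁⟩ := nonempty_kerMapMkQ_linearEquiv_kerQuotient (K.d i j).hom (K.d j l).hom
  -- `ker g ⧸ (im f ∩ ker g) = ker g ⧸ im (toCycles)` is the `H` of Mathlib's left homology data of `S`
  have hq : (LinearMap.range (K.d i j).hom).comap (LinearMap.ker (K.d j l).hom).subtype = LinearMap.range S.moduleCatToCycles :=
    (range_moduleCatToCycles_eq S).symm
  let e₂ : (↥(LinearMap.ker (K.d j l).hom) ⧸ (LinearMap.range (K.d i j).hom).comap (LinearMap.ker (K.d j l).hom).subtype) ≃ₗ[R]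
      S.moduleCatLeftHomologyData.H :=
    Submodule.quotEquivOfEq _ _ hq
  let e₃ : S.moduleCatLeftHomologyData.H ≃ₗ[R] K.homology j :=
    (S.moduleCatHomologyIso.symm ≪≫ (K.homologyIsoSc' i j l hi hl).symm).toLinearEquiv
  exact ⟨e₁.trans (e₂.trans e₃)⟩

end Homology

/-! ## §3 Invariance under quasi-isomorphisms -/

section QuasiIso

variable {R : Type u} [CommRing R] {K L : CochainComplex (ModuleCat.{u} R) ℤ} (F : K ⟶ L)

/-- **The map-`mkQ` cohomologies of quasi-isomorphic complexes agree**: for `F : K ⟶ L` a quasi-isomorphism in degree `j` (`i + 1 = j`, `j + 1 = l`),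
`↥((ker d_K^{j,l}).map (range d_K^{i,j}).mkQ) ≃ₗ[R] ↥((ker d_L^{j,l}).map (range d_L^{i,j}).mkQ)` (§2 on both sides and `homologyMap F j`, an isomorphism).
[cite: Weibel1994, §1.1 (Def. 1.1.1, Ex. 1.1.2)] [cite: StacksProject, Tag 0111] -/
theorem nonempty_HmkQ_linearEquiv_of_quasiIsoAt (i j l : ℤ) (hij : i + 1 = j) (hjl : j + 1 = l) [QuasiIsoAt F j] :
    Nonempty (↥((LinearMap.ker (K.d j l).hom).map (LinearMap.range (K.d i j).hom).mkQ) ≃ₗ[R]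
      ↥((LinearMap.ker (L.d j l).hom).map (LinearMap.range (L.d i j).hom).mkQ)) := by
  obtain ⟨eK⟩ := nonempty_HmkQ_linearEquiv_homology K i j l hij hjl
  obtain ⟨eL⟩ := nonempty_HmkQ_linearEquiv_homology L i j l hij hjl
  let eF : K.homology j ≃ₗ[R] L.homology j := (asIso (homologyMap F j)).toLinearEquiv
  exact ⟨eK.trans (eF.trans eL.symm)⟩

/-- **Equal `finrank` of the map-`mkQ` cohomologies of quasi-isomorphic complexes** (degree `j`, `F` a quasi-isomorphism in degree `j`).
[cite: Weibel1994, §1.1 (Def. 1.1.1, Ex. 1.1.2)] [cite: StacksProject, Tag 0111] -/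
theorem finrank_HmkQ_eq_of_quasiIsoAt (i j l : ℤ) (hij : i + 1 = j) (hjl : j + 1 = l) [QuasiIsoAt F j] :
    Module.finrank R ↥((LinearMap.ker (K.d j l).hom).map (LinearMap.range (K.d i j).hom).mkQ) =
      Module.finrank R ↥((LinearMap.ker (L.d j l).hom).map (LinearMap.range (L.d i j).hom).mkQ) := by
  obtain ⟨e⟩ := nonempty_HmkQ_linearEquiv_of_quasiIsoAt F i j l hij hjl
  exact e.finrank_eq

/-- The same for a quasi-isomorphism (all degrees). [cite: StacksProject, Tag 0111] -/
theorem finrank_HmkQ_eq_of_quasiIso (i j l : ℤ) (hij : i + 1 = j) (hjl : j + 1 = l) [QuasiIso F] :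
    Module.finrank R ↥((LinearMap.ker (K.d j l).hom).map (LinearMap.range (K.d i j).hom).mkQ) =
      Module.finrank R ↥((LinearMap.ker (L.d j l).hom).map (LinearMap.range (L.d i j).hom).mkQ) :=
  finrank_HmkQ_eq_of_quasiIsoAt F i j l hij hjl

end QuasiIso

end Literature.Algebra.Homology

end
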